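import Literature.Analysis.FluidPDE.CaloricRemainderEnergyWindow
import Literature.Analysis.FluidPDE.SerrinEnstrophyGronwall
import Mathlib.Analysis.SpecialFunctions.Integrals.Basic
import HarnessLib

/-!
# The energy bound of the caloric remainder up to the final time

Analysis/FluidPDE proof file (theorems only) on the Calderón / Rusin–Šverák route to the far-field
regularity of Kato's mild `L³` solution near the blow-up time
(`Literature.Analysis.FluidPDE.IsKatoSolutionOn.farField_bound`; W. Rusin, V. Šverák, J. Funct.
Anal. 260 (2011) = arXiv:0911.0500, §4 p. 6: "the equation for `v`, together with the local energy
inequality, implies that `v` is in the energy class `L^∞_t L²_x ∩ L²_t Ḣ¹_x` up to the blow-up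
time"; C. P. Calderón, Trans. AMS 318 (1990), §1; P. G. Lemarié-Rieusset, *The Navier–Stokes
problem in the 21st century* (2016), Prop. 15.1 and proof of Thm. 14.7, pp. 516–518).

From the window inequality `caloric_remainder_window_inequality`
(`y_R(b) + ν∫_a^b g_R ≤ y_R(a) + ∫_a^b (α y_R + β₀) + Err/R`) we let `a → 0` (`y_R(a) → 0` since
`u(0) = u₀ = e^{0·Δ}u₀` and `u, e^{νtΔ}u₀ ∈ C([0, S); L³)`), apply Grönwall's lemma with the
integrable kernel `α(t) = 2 · 2^{3/2} M (νt)^{-1/2}` (`lintegral_gronwall_le`), and finally let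
`R → ∞` (Fatou). The result (`caloric_remainder_energy_bound`) is the energy bound of the remainder
`w = u - e^{νtΔ}u₀`, for `0 < t < S`,

  `∫ |w(t)|² ≤ K`,  `ν ∫₀ᵗ ∫ |G - De|² ≤ K`,
  `K = (M ‖u₀‖₃³ S / ν) (1 + A) e^{A}`, `A = 2 · 2^{3/2} ν^{-1/2} M · 2 S^{1/2} = ∫₀^S α`,

with a constant depending only on `M ⩾ |u₀|`, `‖u₀‖₃`, `ν` and (monotonically) on `S` — not on
the solution: this is what makes the bound usable up to the blow-up time.

## Mathlib / tree search

Tree: `caloric_remainder_window_inequality`, `integrableOn_frobeniusNormSq_sub_fderiv_heatFlow_box`,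
`continuousOn_integral_norm_sq_sub_heatFlow_mul_cutoff` (`CaloricRemainderEnergyWindow.lean`);
`lintegral_gronwall_le` (`SerrinEnstrophyGronwall.lean`); `integrable_of_bound_on_compact`
(`CaloricRemainderLocalEnergy.lean`); `cutoff_eq_one`, `cutoff_nonneg`, `cutoff_le_one`,
`cutoff_eq_zero`, `heatFlow_zero`, `memLp_heatFlow_holds`. Mathlib: `integral_rpow`,
`setLIntegral_iUnion_of_directed`, `lintegral_liminf_le'`, `ofReal_integral_eq_lintegral_ofReal`.

## References

* W. Rusin, V. Šverák, J. Funct. Anal. 260 (2011) 879–891 = arXiv:0911.0500, §4 p. 6.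
  [RusinSverak2011]
* P. G. Lemarié-Rieusset, *The Navier–Stokes problem in the 21st century*, CRC Press 2016,
  Prop. 15.1; Thm. 14.7, proof pp. 516–518. [LemarieRieusset2016]
-/

noncomputable section

open MeasureTheory TopologicalSpace Set Function Filter Topology Metric Real InnerProductSpace

open scoped ENNReal NNReal RealInnerProductSpace Laplacian

namespace Literature.Analysis.FluidPDE

/-! ### Tools -/

section Tools

variable {S ν M : ℝ} {u₀ : (EuclideanSpace ℝ (Fin 3)) → (EuclideanSpace ℝ (Fin 3))} {u : ℝ → (EuclideanSpace ℝ (Fin 3)) → (EuclideanSpace ℝ (Fin 3))} {G : ℝ → (EuclideanSpace ℝ (Fin 3)) → (EuclideanSpace ℝ (Fin 3)) →L[ℝ] (EuclideanSpace ℝ (Fin 3))}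

/-- `|v|² χ_R` is integrable for `v ∈ L³` (`|v|² χ_R ≤ |v|³ + 1_{B̄(0, 2R)}`). [folklore] -/
theorem integrable_norm_sq_mul_cutoff {v : (EuclideanSpace ℝ (Fin 3)) → (EuclideanSpace ℝ (Fin 3))} (hv : MemLp v 3 volume) {R : ℝ} (hR : 0 < R) :
    Integrable (fun x => ‖v x‖ ^ 2 * cutoff R x) volume := by
  have h3 : Integrable (fun x => ‖v x‖ ^ 3) volume := hv.integrable_norm_pow (by norm_num)
  have hind : Integrable (indicator (closedBall (0 : (EuclideanSpace ℝ (Fin 3))) (2 * R)) fun _ => (1 : ℝ)) volume :=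
    (integrable_indicator_iff measurableSet_closedBall).2 (integrableOn_const (hs := measure_closedBall_lt_top.ne))
  refine Integrable.mono' (h3.add hind)
    ((hv.aestronglyMeasurable.norm.pow 2).mul (contDiff_cutoff (E := (EuclideanSpace ℝ (Fin 3))) (n := 0) R).continuous.aestronglyMeasurable)
    (ae_of_all _ fun x => ?_)
  rw [Real.norm_eq_abs, abs_of_nonneg (mul_nonneg (sq_nonneg _) (cutoff_nonneg R x))]
  by_cases hx : x ∈ closedBall (0 : (EuclideanSpace ℝ (Fin 3))) (2 * R)
  · show ‖v x‖ ^ 2 * cutoff R x ≤ ‖v x‖ ^ 3 + indicator (closedBall (0 : (EuclideanSpace ℝ (Fin 3))) (2 * R)) (fun _ => (1 : ℝ)) x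
    rw [indicator_of_mem hx]
    calc ‖v x‖ ^ 2 * cutoff R x ≤ ‖v x‖ ^ 2 * 1 := mul_le_mul_of_nonneg_left (cutoff_le_one R x) (sq_nonneg _)
      _ ≤ ‖v x‖ ^ 3 + 1 := by nlinarith [sq_nonneg (‖v x‖ - 1), sq_nonneg ‖v x‖, norm_nonneg (v x)]
  · rw [mem_closedBall_zero_iff, not_le] at hx
    show ‖v x‖ ^ 2 * cutoff R x ≤ ‖v x‖ ^ 3 + indicator (closedBall (0 : (EuclideanSpace ℝ (Fin 3))) (2 * R)) (fun _ => (1 : ℝ)) x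
    rw [cutoff_eq_zero hR hx.le, mul_zero]
    exact add_nonneg (pow_nonneg (norm_nonneg _) 3) (indicator_nonneg (fun _ _ => zero_le_one) _)

/-- The kernel `α(s) = 2 · 2^{3/2} M (νs)^{-1/2}` is integrable on `(0, t)` with
`∫₀ᵗ α = 2 · 2^{3/2} ν^{-1/2} M · 2 t^{1/2}`. [folklore] -/
theorem integrableOn_kernel_and_integral_eq (hν : 0 < ν) (M : ℝ) {t : ℝ} (ht : 0 ≤ t) :
    IntegrableOn (fun s : ℝ => 2 * (2 ^ ((3 : ℝ) / 2) * (ν * s) ^ (-(1 / 2 : ℝ)) * M)) (Ioo 0 t) volume ∧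
    ∫ s in Ioo 0 t, 2 * (2 ^ ((3 : ℝ) / 2) * (ν * s) ^ (-(1 / 2 : ℝ)) * M) =
      2 * (2 ^ ((3 : ℝ) / 2) * ν ^ (-(1 / 2 : ℝ)) * M) * (2 * t ^ ((1 : ℝ) / 2)) := by
  have hr : (-1 : ℝ) < -(1 / 2 : ℝ) := by norm_num
  have hii : IntervalIntegrable (fun s : ℝ => s ^ (-(1 / 2 : ℝ))) volume 0 t :=
    intervalIntegral.intervalIntegrable_rpow' hr
  have hI : IntegrableOn (fun s : ℝ => s ^ (-(1 / 2 : ℝ))) (Ioo 0 t) volume := by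
    have h := (intervalIntegrable_iff_integrableOn_Ioc_of_le ht).1 hii
    exact h.mono_set Ioo_subset_Ioc_self
  have heq : EqOn (fun s : ℝ => 2 * (2 ^ ((3 : ℝ) / 2) * (ν * s) ^ (-(1 / 2 : ℝ)) * M))
      (fun s : ℝ => (2 * (2 ^ ((3 : ℝ) / 2) * ν ^ (-(1 / 2 : ℝ)) * M)) * s ^ (-(1 / 2 : ℝ))) (Ioo 0 t) := by
    intro s hs
    show 2 * (2 ^ ((3 : ℝ) / 2) * (ν * s) ^ (-(1 / 2 : ℝ)) * M) =
      (2 * (2 ^ ((3 : ℝ) / 2) * ν ^ (-(1 / 2 : ℝ)) * M)) * s ^ (-(1 / 2 : ℝ))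
    rw [Real.mul_rpow hν.le hs.1.le]; ring
  have hI2 : IntegrableOn (fun s : ℝ => (2 * (2 ^ ((3 : ℝ) / 2) * ν ^ (-(1 / 2 : ℝ)) * M)) * s ^ (-(1 / 2 : ℝ)))
      (Ioo 0 t) volume := hI.const_mul _
  refine ⟨hI2.congr_fun heq.symm measurableSet_Ioo, ?_⟩
  rw [setIntegral_congr_fun measurableSet_Ioo heq, integral_const_mul, ← integral_Ioc_eq_integral_Ioo,
    ← intervalIntegral.integral_of_le ht, integral_rpow (Or.inl hr)]
  congr 1
  rw [Real.zero_rpow (by norm_num), sub_zero]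
  norm_num
  ring

end Tools

/-! ### Fubini for the cut-off dissipation -/

section Fubini

variable {S ν M : ℝ} {u₀ : (EuclideanSpace ℝ (Fin 3)) → (EuclideanSpace ℝ (Fin 3))} {u : ℝ → (EuclideanSpace ℝ (Fin 3)) → (EuclideanSpace ℝ (Fin 3))} {G : ℝ → (EuclideanSpace ℝ (Fin 3)) → (EuclideanSpace ℝ (Fin 3)) →L[ℝ] (EuclideanSpace ℝ (Fin 3))}

/-- The cut-off dissipation of the remainder on `[a, b] ⊂ (0, S)`: `t ↦ g_R(t) = ∫ |G - De|² χ_R`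
is integrable on `[a, b]` and `ν ∫_{[a,b]} g_R`, read in `[0, ∞]`, is the space–time integral
`ν ∫∫_{[a,b] × ℝ³} |G - De|² χ_R` (Fubini–Tonelli). [folklore] -/
theorem integrableOn_cutoffDissipation_and_ofReal_eq (hν : 0 < ν) (hM0 : 0 ≤ M)
    (hMb : ∀ x, ‖u₀ x‖ ≤ M) (hu₀ : MemLp u₀ 3 volume)
    (hG : HasWeakSpatialGradientOn (slab (EuclideanSpace ℝ (Fin 3)) (Ioo 0 S) isOpen_Ioo) u G)
    (hG2 : ∀ K ⊆ ((slab (EuclideanSpace ℝ (Fin 3)) (Ioo 0 S) isOpen_Ioo : Opens (ℝ × (EuclideanSpace ℝ (Fin 3)))) : Set (ℝ × (EuclideanSpace ℝ (Fin 3)))), IsCompact K →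
      ∫⁻ z in K, ENNReal.ofReal (frobeniusNormSq (G z.1 z.2)) < ∞)
    {a b R : ℝ} (ha : 0 < a) (hbS : b < S) (hR : 0 < R) :
    IntegrableOn (fun t => (∫ x, frobeniusNormSq (G t x - fderiv ℝ (heatFlow u₀ (ν * t)) x) * cutoff R x)) (Icc a b) volume ∧
    ENNReal.ofReal (∫ t in Icc a b, (∫ x, frobeniusNormSq (G t x - fderiv ℝ (heatFlow u₀ (ν * t)) x) * cutoff R x)) = ∫⁻ z in Icc a b ×ˢ (univ : Set (EuclideanSpace ℝ (Fin 3))), ENNReal.ofReal (frobeniusNormSq (G z.1 z.2 - fderiv ℝ (heatFlow u₀ (ν * z.1)) z.2) * cutoff R z.2) := by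
  obtain ⟨hFK, hFm⟩ := integrableOn_frobeniusNormSq_sub_fderiv_heatFlow_box (ρ := 2 * R) hν hM0 hMb hu₀ hG hG2 ha hbS
  set Kb : Set (ℝ × (EuclideanSpace ℝ (Fin 3))) := Icc a b ×ˢ closedBall (0 : (EuclideanSpace ℝ (Fin 3))) (2 * R) with hKb
  have hKbc : IsCompact Kb := isCompact_Icc.prod (isCompact_closedBall _ _)
  have hKbstrip : Kb ⊆ Ioo 0 S ×ˢ (univ : Set (EuclideanSpace ℝ (Fin 3))) := fun z hz =>
    ⟨⟨ha.trans_le hz.1.1, hz.1.2.trans_lt hbS⟩, mem_univ _⟩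
  have hχ0 : ∀ x : (EuclideanSpace ℝ (Fin 3)), 0 ≤ cutoff R x := fun x => cutoff_nonneg R x
  have hχ1 : ∀ x : (EuclideanSpace ℝ (Fin 3)), cutoff R x ≤ 1 := fun x => cutoff_le_one R x
  have hχz : ∀ x : (EuclideanSpace ℝ (Fin 3)), x ∉ closedBall (0 : (EuclideanSpace ℝ (Fin 3))) (2 * R) → cutoff R x = 0 := fun x hx => by
    rw [mem_closedBall_zero_iff, not_le] at hx
    exact cutoff_eq_zero hR hx.le
  have hχm : AEStronglyMeasurable (fun z : ℝ × (EuclideanSpace ℝ (Fin 3)) => cutoff R z.2) (volume.restrict Kb) :=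
    ((contDiff_cutoff (E := (EuclideanSpace ℝ (Fin 3))) (n := 0) R).continuous.comp continuous_snd).aestronglyMeasurable
  set P : ℝ × (EuclideanSpace ℝ (Fin 3)) → ℝ := indicator (Icc a b ×ˢ (univ : Set (EuclideanSpace ℝ (Fin 3)))) fun z => (frobeniusNormSq (G z.1 z.2 - fderiv ℝ (heatFlow u₀ (ν * z.1)) z.2) * cutoff R z.2) with hP
  have hPdef : ∀ z : ℝ × (EuclideanSpace ℝ (Fin 3)), P z = indicator (Icc a b ×ˢ (univ : Set (EuclideanSpace ℝ (Fin 3)))) (fun z => (frobeniusNormSq (G z.1 z.2 - fderiv ℝ (heatFlow u₀ (ν * z.1)) z.2) * cutoff R z.2)) z := fun z => rfl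
  have hP0 : ∀ z, 0 ≤ P z := fun z =>
    indicator_nonneg (fun z _ => mul_nonneg (frobeniusNormSq_nonneg _) (hχ0 _)) _
  have hPi : Integrable P volume := by
    refine integrable_of_bound_on_compact hKbc hFK ?_ (fun z hz => ?_) (fun z hz => ?_)
    · exact ((hFm.mono_measure (Measure.restrict_mono hKbstrip le_rfl)).mul hχm).indicator
        (measurableSet_Icc.prod MeasurableSet.univ)
    · rw [hKb, mem_prod, not_and_or] at hz
      rcases hz with h | h
      · exact indicator_of_notMem (fun h' => h h'.1) _
      · rw [hPdef]
        by_cases hz' : z ∈ Icc a b ×ˢ (univ : Set (EuclideanSpace ℝ (Fin 3)))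
        · rw [indicator_of_mem hz', hχz z.2 h, mul_zero]
        · exact indicator_of_notMem hz' _
    · rw [hPdef, indicator_of_mem (show z ∈ Icc a b ×ˢ (univ : Set (EuclideanSpace ℝ (Fin 3))) from ⟨hz.1, mem_univ _⟩), Real.norm_eq_abs,
        abs_of_nonneg (mul_nonneg (frobeniusNormSq_nonneg _) (hχ0 _))]
      exact mul_le_of_le_one_right (frobeniusNormSq_nonneg _) (hχ1 _)
  have hslice : ∀ t, (∫ x, P (t, x)) = indicator (Icc a b) (fun t => (∫ x, frobeniusNormSq (G t x - fderiv ℝ (heatFlow u₀ (ν * t)) x) * cutoff R x)) t := by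
    intro t
    by_cases ht : t ∈ Icc a b
    · rw [indicator_of_mem ht]
      refine integral_congr_ae (ae_of_all _ fun x => ?_)
      exact indicator_of_mem (show (t, x) ∈ Icc a b ×ˢ (univ : Set (EuclideanSpace ℝ (Fin 3))) from ⟨ht, mem_univ _⟩) _
    · rw [indicator_of_notMem ht]
      refine (integral_congr_ae (ae_of_all _ fun x => ?_)).trans (integral_zero _ _)
      exact indicator_of_notMem (fun h => ht h.1) _
  have hgI : Integrable (indicator (Icc a b) fun t => (∫ x, frobeniusNormSq (G t x - fderiv ℝ (heatFlow u₀ (ν * t)) x) * cutoff R x)) volume :=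
    hPi.integral_prod_left.congr (ae_of_all _ hslice)
  refine ⟨(integrable_indicator_iff measurableSet_Icc).1 hgI, ?_⟩
  have h1 : (∫ t in Icc a b, (∫ x, frobeniusNormSq (G t x - fderiv ℝ (heatFlow u₀ (ν * t)) x) * cutoff R x)) = ∫ z, P z := by
    rw [← integral_indicator measurableSet_Icc, Measure.volume_eq_prod, integral_prod P (by
      rw [← Measure.volume_eq_prod]; exact hPi)]
    exact integral_congr_ae (ae_of_all _ fun t => (hslice t).symm)
  rw [h1, ofReal_integral_eq_lintegral_ofReal hPi (ae_of_all _ hP0), ← lintegral_indicator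
    (measurableSet_Icc.prod MeasurableSet.univ)]
  refine lintegral_congr fun z => ?_
  rw [hPdef]
  by_cases hz : z ∈ Icc a b ×ˢ (univ : Set (EuclideanSpace ℝ (Fin 3)))
  · rw [indicator_of_mem hz, indicator_of_mem hz]
  · rw [indicator_of_notMem hz, indicator_of_notMem hz, ENNReal.ofReal_zero]

end Fubini

/-! ### The energy bound -/

section Bound

variable {S ν M : ℝ} {u₀ : (EuclideanSpace ℝ (Fin 3)) → (EuclideanSpace ℝ (Fin 3))} {u : ℝ → (EuclideanSpace ℝ (Fin 3)) → (EuclideanSpace ℝ (Fin 3))} {p : ℝ → (EuclideanSpace ℝ (Fin 3)) → ℝ} {G : ℝ → (EuclideanSpace ℝ (Fin 3)) → (EuclideanSpace ℝ (Fin 3)) →L[ℝ] (EuclideanSpace ℝ (Fin 3))}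

set_option maxHeartbeats 1600000 in
/-- **The caloric remainder lies in the energy class, with an a priori bound** (Rusin–Šverák
2011, §4 p. 6; Calderón 1990, §1; Lemarié-Rieusset 2016, Prop. 15.1 / proof of Thm. 14.7,
pp. 516–518). In the setting of `caloric_remainder_window_inequality` and with `u(0) = u₀` almost
everywhere, the
remainder `w = u - e^{νtΔ}u₀` satisfies, for every `0 < t < S`,
`∫ |w(t)|² ≤ K` and `ν ∫₀ᵗ∫ |G - De|² ≤ K` with
`K = (M ‖u₀‖₃³ S / ν)(1 + A) e^{A}`, `A = 2 · 2^{3/2} ν^{-1/2} M · 2√S`: a bound depending only on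
`M ≥ |u₀|`, `‖u₀‖₃`, `ν` and monotonically on `S`. [cite: RusinSverak2011, §4 p. 6] -/
theorem caloric_remainder_energy_bound_ae (hν : 0 < ν) (hS : 0 < S) (hM0 : 0 ≤ M)
    (hMb : ∀ x, ‖u₀ x‖ ≤ M) (hu₀ : MemLp u₀ 3 volume) (hdiv₀ : IsWeaklyDivFree u₀)
    (hNS : IsDistributionalNSSolutionOn (slab (EuclideanSpace ℝ (Fin 3)) (Ioo 0 S) isOpen_Ioo) ν 0 u p)
    (hG : HasWeakSpatialGradientOn (slab (EuclideanSpace ℝ (Fin 3)) (Ioo 0 S) isOpen_Ioo) u G)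
    (hG2 : ∀ K ⊆ ((slab (EuclideanSpace ℝ (Fin 3)) (Ioo 0 S) isOpen_Ioo : Opens (ℝ × (EuclideanSpace ℝ (Fin 3)))) : Set (ℝ × (EuclideanSpace ℝ (Fin 3)))), IsCompact K →
      ∫⁻ z in K, ENNReal.ofReal (frobeniusNormSq (G z.1 z.2)) < ∞)
    (hLEI : ∀ φ : ℝ → (EuclideanSpace ℝ (Fin 3)) → ℝ, IsSpaceTimeTestOn (slab (EuclideanSpace ℝ (Fin 3)) (Ioo 0 S) isOpen_Ioo) φ → (∀ t x, 0 ≤ φ t x) →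
      2 * ν * ∫ t, ∫ x, frobeniusNormSq (G t x) * φ t x ≤
        ∫ t, ∫ x, (‖u t x‖ ^ 2 * (timeDeriv φ t x + ν * Δ (φ t) x) +
          (‖u t x‖ ^ 2 + 2 * p t x) * ⟪u t x, gradient (φ t) x⟫ +
          2 * ⟪(0 : ℝ → (EuclideanSpace ℝ (Fin 3)) → (EuclideanSpace ℝ (Fin 3))) t x, u t x⟫ * φ t x))
    (hu3 : MemLp (uncurry u) 3 (volume.restrict (Ioo 0 S ×ˢ univ)))
    (hp32 : MemLp (uncurry p) (3 / 2) (volume.restrict (Ioo 0 S ×ˢ univ)))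
    (hcont : ContinuousInLpOn (Ico 0 S) 3 u) (hinit : u 0 =ᵐ[volume] u₀) {t : ℝ} (ht : t ∈ Ioo 0 S) :
    (∫⁻ x, ‖u t x - heatFlow u₀ (ν * t) x‖ₑ ^ 2 ≤
      ENNReal.ofReal ((M * (∫ x, ‖u₀ x‖ ^ 3) * S / ν) * (1 + (2 * (2 ^ ((3 : ℝ) / 2) * ν ^ (-(1 / 2 : ℝ)) * M) * (2 * S ^ ((1 : ℝ) / 2)))) * Real.exp (2 * (2 ^ ((3 : ℝ) / 2) * ν ^ (-(1 / 2 : ℝ)) * M) * (2 * S ^ ((1 : ℝ) / 2))))) ∧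
    ENNReal.ofReal ν * ∫⁻ z in Ioc 0 t ×ˢ (univ : Set (EuclideanSpace ℝ (Fin 3))),
        ENNReal.ofReal (frobeniusNormSq (G z.1 z.2 - fderiv ℝ (heatFlow u₀ (ν * z.1)) z.2)) ≤
      ENNReal.ofReal ((M * (∫ x, ‖u₀ x‖ ^ 3) * S / ν) * (1 + (2 * (2 ^ ((3 : ℝ) / 2) * ν ^ (-(1 / 2 : ℝ)) * M) * (2 * S ^ ((1 : ℝ) / 2)))) * Real.exp (2 * (2 ^ ((3 : ℝ) / 2) * ν ^ (-(1 / 2 : ℝ)) * M) * (2 * S ^ ((1 : ℝ) / 2)))) := by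
  obtain ⟨Err, hErr0, hW⟩ := caloric_remainder_window_inequality hν hS hM0 hMb hu₀ hdiv₀ hNS hG hG2 hLEI
    hu3 hp32 hcont
  obtain ⟨ht0, htS⟩ := ht
  set N3 : ℝ := ∫ x, ‖u₀ x‖ ^ 3 with hN3
  have hN30 : 0 ≤ N3 := integral_nonneg fun _ => by positivity
  set β₀ : ℝ := M * N3 / ν with hβ₀
  have hβ₀0 : 0 ≤ β₀ := by positivity
  set A : ℝ := (2 * (2 ^ ((3 : ℝ) / 2) * ν ^ (-(1 / 2 : ℝ)) * M) * (2 * S ^ ((1 : ℝ) / 2))) with hA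
  have hA0 : 0 ≤ A := by positivity
  have hexp1 : 1 ≤ Real.exp A := Real.one_le_exp hA0
  -- the kernel and its integral
  set α : ℝ → ℝ := fun s => (2 * (2 ^ ((3 : ℝ) / 2) * (ν * s) ^ (-(1 / 2 : ℝ)) * M)) with hα
  have hα0 : ∀ s, 0 < s → 0 ≤ α s := fun s hs => by
    rw [hα]; exact mul_nonneg two_pos.le (mul_nonneg (mul_nonneg (by positivity)
      (Real.rpow_nonneg (mul_nonneg hν.le hs.le) _)) hM0)
  have hαI : ∀ s, 0 ≤ s → s ≤ S → IntegrableOn α (Ioo 0 s) volume ∧ ∫ r in Ioo 0 s, α r ≤ A := by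
    intro s hs hst
    obtain ⟨h1, h2⟩ := integrableOn_kernel_and_integral_eq hν M hs
    refine ⟨h1, ?_⟩
    show ∫ r in Ioo 0 s, 2 * (2 ^ ((3 : ℝ) / 2) * (ν * r) ^ (-(1 / 2 : ℝ)) * M) ≤ A
    rw [h2, hA]
    exact mul_le_mul_of_nonneg_left (mul_le_mul_of_nonneg_left
      (Real.rpow_le_rpow hs hst (by norm_num)) two_pos.le) (by positivity)
  have hIcc : Icc 0 t ⊆ Ico 0 S := fun s hs => ⟨hs.1, hs.2.trans_lt htS⟩
  -- ### Step A: the bounds at a fixed cut-off radius `R`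
  have stepR : ∀ R : ℝ, 0 < R →
      (∫ x, ‖u t x - heatFlow u₀ (ν * t) x‖ ^ 2 * cutoff R x) ≤ (β₀ * S + Err / R) * Real.exp A ∧
      ENNReal.ofReal ν * ∫⁻ z in Ioc 0 t ×ˢ (univ : Set (EuclideanSpace ℝ (Fin 3))), ENNReal.ofReal (frobeniusNormSq (G z.1 z.2 - fderiv ℝ (heatFlow u₀ (ν * z.1)) z.2) * cutoff R z.2) ≤
        ENNReal.ofReal ((β₀ * S + Err / R) * (1 + A) * Real.exp A) := by
    intro R hR
    set y : ℝ → ℝ := fun s => (∫ x, ‖u s x - heatFlow u₀ (ν * s) x‖ ^ 2 * cutoff R x) with hy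
    have hydef : ∀ s, y s = (∫ x, ‖u s x - heatFlow u₀ (ν * s) x‖ ^ 2 * cutoff R x) := fun s => rfl
    have hyc : ContinuousOn y (Ico 0 S) := continuousOn_integral_norm_sq_sub_heatFlow_mul_cutoff hν hu₀ hcont hR
    have hy0 : ∀ s, 0 ≤ y s := fun s => integral_nonneg fun x => mul_nonneg (sq_nonneg _) (cutoff_nonneg R x)
    have hy00 : y 0 = 0 := by
      rw [hydef]
      refine (integral_congr_ae (hinit.mono fun x hx => ?_)).trans (integral_zero _ _)
      show ‖u 0 x - heatFlow u₀ (ν * 0) x‖ ^ 2 * cutoff R x = 0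
      rw [mul_zero, heatFlow_zero, hx, sub_self, norm_zero]; ring
    obtain ⟨Ymax, hYmax⟩ := isCompact_Icc.exists_bound_of_continuousOn (hyc.mono hIcc)
    have hym : ∀ s ∈ Ioc 0 t, AEStronglyMeasurable y (volume.restrict (Ioc 0 s)) := fun s hs =>
      ((hyc.mono ((Icc_subset_Icc_right hs.2).trans hIcc)).aestronglyMeasurable measurableSet_Icc).mono_measure
        (Measure.restrict_mono Ioc_subset_Icc_self le_rfl)
    -- integrability of `α y` on `(0, s]`
    have hαyI : ∀ s ∈ Ioc 0 t, IntegrableOn (fun r => α r * y r) (Ioc 0 s) volume := by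
      intro s hs
      have h1 : IntegrableOn α (Ioc 0 s) volume :=
        (hαI s hs.1.le (hs.2.trans htS.le)).1.congr_set_ae (Ioo_ae_eq_Ioc (μ := (volume : Measure ℝ))).symm
      have h2 : IntegrableOn (fun r => y r * α r) (Ioc 0 s) volume := by
        refine Integrable.bdd_mul (c := Ymax) h1 (hym s hs) ((ae_restrict_iff' measurableSet_Ioc).2
          (ae_of_all _ fun r hr => hYmax r ⟨hr.1.le, hr.2.trans hs.2⟩))
      exact h2.congr (ae_of_all _ fun r => mul_comm _ _)
    have hαy0 : ∀ s ∈ Ioc 0 t, 0 ≤ᵐ[volume.restrict (Ioc 0 s)] fun r => α r * y r := fun s hs =>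
      (ae_restrict_iff' measurableSet_Ioc).2 (ae_of_all _ fun r hr => mul_nonneg (hα0 r hr.1) (hy0 r))
    -- #### Step 1: `a → 0` in the window inequality
    have step1 : ∀ s ∈ Ioc 0 t,
        y s ≤ (∫ r in Ioc 0 s, α r * y r) + β₀ * s + Err / R ∧
        ENNReal.ofReal ν * ∫⁻ z in Ioc 0 s ×ˢ (univ : Set (EuclideanSpace ℝ (Fin 3))), ENNReal.ofReal (frobeniusNormSq (G z.1 z.2 - fderiv ℝ (heatFlow u₀ (ν * z.1)) z.2) * cutoff R z.2) ≤
          ENNReal.ofReal ((∫ r in Ioc 0 s, α r * y r) + β₀ * s + Err / R) := by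
      intro s hs
      have hs0 : 0 < s := hs.1
      have hsS : s < S := hs.2.trans_lt htS
      set I : ℝ := (∫ r in Ioc 0 s, α r * y r) + β₀ * s with hI
      -- the window inequality with the right-hand side enlarged to `(0, s]`
      have hwin : ∀ a, 0 < a → a < s →
          y s + ν * (∫ r in Icc a s, (∫ x, frobeniusNormSq (G r x - fderiv ℝ (heatFlow u₀ (ν * r)) x) * cutoff R x)) ≤ y a + I + Err / R := by
        intro a ha has
        have h := hW a s ha has hsS R hR
        have hmono : (∫ r in Icc a s, (α r * (∫ x, ‖u r x - heatFlow u₀ (ν * r) x‖ ^ 2 * cutoff R x) + β₀)) ≤ I := by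
          have hi : IntegrableOn (fun r => α r * y r + β₀) (Ioc 0 s) volume :=
            (hαyI s hs).add (integrableOn_const (hs := measure_Ioc_lt_top.ne))
          calc (∫ r in Icc a s, (α r * (∫ x, ‖u r x - heatFlow u₀ (ν * r) x‖ ^ 2 * cutoff R x) + β₀)) ≤ ∫ r in Ioc 0 s, (α r * y r + β₀) := by
                refine setIntegral_mono_set hi ?_ (ae_of_all _ fun r (hr : r ∈ Icc a s) =>
                  show r ∈ Ioc 0 s from ⟨ha.trans_le hr.1, hr.2⟩)
                exact (ae_restrict_iff' measurableSet_Ioc).2 (ae_of_all _ fun r hr =>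
                  add_nonneg (mul_nonneg (hα0 r hr.1) (hy0 r)) hβ₀0)
            _ = I := by
                rw [integral_add (hαyI s hs) (integrableOn_const (hs := measure_Ioc_lt_top.ne)), setIntegral_const,
                  Real.volume_real_Ioc, sub_zero, max_eq_left hs0.le, smul_eq_mul, hI]
                ring
        have e1 : (∫ x, ‖u s x - heatFlow u₀ (ν * s) x‖ ^ 2 * cutoff R x) = y s := rfl
        have e2 : (∫ x, ‖u a x - heatFlow u₀ (ν * a) x‖ ^ 2 * cutoff R x) = y a := rfl
        rw [e1, e2] at h
        linarith
      -- the sequence `aₙ = s/(n+2) → 0⁺` and `y(aₙ) → y(0) = 0`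
      set an : ℕ → ℝ := fun n => s / ((n : ℝ) + 2) with han
      have han0 : ∀ n, 0 < an n := fun n => by positivity
      have hans : ∀ n, an n < s := fun n => by
        rw [han]; dsimp only; rw [div_lt_iff₀ (by positivity)]; nlinarith [(Nat.cast_nonneg n : (0 : ℝ) ≤ n)]
      have hanlim : Tendsto an atTop (𝓝 0) :=
        tendsto_const_nhds.div_atTop (tendsto_natCast_atTop_atTop.atTop_add tendsto_const_nhds)
      have hylim : Tendsto (fun n => y (an n)) atTop (𝓝 0) := by
        have hcw : ContinuousWithinAt y (Ico 0 S) 0 := hyc 0 ⟨le_rfl, hS⟩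
        rw [← hy00]
        refine hcw.tendsto.comp (tendsto_nhdsWithin_iff.2 ⟨hanlim, Eventually.of_forall fun n => ?_⟩)
        exact ⟨(han0 n).le, (hans n).trans hsS⟩
      refine ⟨?_, ?_⟩
      · -- (i)
        have hk : ∀ n, y s ≤ y (an n) + I + Err / R := by
          intro n
          have h := hwin (an n) (han0 n) (hans n)
          have hg0 : 0 ≤ ν * ∫ r in Icc (an n) s, (∫ x, frobeniusNormSq (G r x - fderiv ℝ (heatFlow u₀ (ν * r)) x) * cutoff R x) :=
            mul_nonneg hν.le (setIntegral_nonneg measurableSet_Icc fun r _ =>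
              integral_nonneg fun x => mul_nonneg (frobeniusNormSq_nonneg _) (cutoff_nonneg R x))
          linarith
        have hlim : Tendsto (fun n => y (an n) + I + Err / R) atTop (𝓝 (0 + I + Err / R)) :=
          (hylim.add tendsto_const_nhds).add tendsto_const_nhds
        have := ge_of_tendsto' hlim hk
        rw [hI] at this
        linarith
      · -- (ii)
        have hanti : Antitone an := fun m n hmn => by
          rw [han]; dsimp only
          exact div_le_div_of_nonneg_left hs0.le (by positivity) (by linarith [(Nat.cast_le.2 hmn : (m : ℝ) ≤ n)])
        have hdir : Directed (· ⊆ ·) fun n : ℕ => Icc (an n) s ×ˢ (univ : Set (EuclideanSpace ℝ (Fin 3))) :=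
          Monotone.directed_le fun m n hmn => prod_mono (Icc_subset_Icc (hanti hmn) le_rfl) Subset.rfl
        have hU : (⋃ n : ℕ, Icc (an n) s ×ˢ (univ : Set (EuclideanSpace ℝ (Fin 3)))) = Ioc 0 s ×ˢ (univ : Set (EuclideanSpace ℝ (Fin 3))) := by
          rw [← iUnion_prod_const]
          congr 1
          refine subset_antisymm (iUnion_subset fun n => (Icc_subset_Ioc_iff (hans n).le).2 ⟨han0 n, le_rfl⟩)
            fun r hr => ?_
          obtain ⟨n, hn⟩ := exists_nat_gt (s / r)
          refine mem_iUnion.2 ⟨n, ⟨?_, hr.2⟩⟩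
          rw [han]; dsimp only
          rw [div_le_iff₀ (by positivity)]
          rw [div_lt_iff₀ hr.1] at hn
          nlinarith [hr.1]
        rw [← hU, setLIntegral_iUnion_of_directed _ hdir, ENNReal.mul_iSup]
        refine iSup_le fun n => ?_
        -- for `m ≥ n`: `ν ∫∫_{[aₙ,s]} ≤ ν ∫∫_{[aₘ,s]} = ofReal (ν ∫_{[aₘ,s]} g) ≤ ofReal (y aₘ + I + Err/R)`
        have hk : ∀ m, n ≤ m → ENNReal.ofReal ν * ∫⁻ z in Icc (an n) s ×ˢ (univ : Set (EuclideanSpace ℝ (Fin 3))), ENNReal.ofReal (frobeniusNormSq (G z.1 z.2 - fderiv ℝ (heatFlow u₀ (ν * z.1)) z.2) * cutoff R z.2) ≤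
            ENNReal.ofReal (y (an m) + I + Err / R) := by
          intro m hmn
          obtain ⟨-, hF⟩ := integrableOn_cutoffDissipation_and_ofReal_eq hν hM0 hMb hu₀ hG hG2 (han0 m) hsS hR
          have hsub : Icc (an n) s ×ˢ (univ : Set (EuclideanSpace ℝ (Fin 3))) ⊆ Icc (an m) s ×ˢ (univ : Set (EuclideanSpace ℝ (Fin 3))) :=
            prod_mono (Icc_subset_Icc (hanti hmn) le_rfl) Subset.rfl
          have hws := hwin (an m) (han0 m) (hans m)
          calc ENNReal.ofReal ν * ∫⁻ z in Icc (an n) s ×ˢ (univ : Set (EuclideanSpace ℝ (Fin 3))), ENNReal.ofReal (frobeniusNormSq (G z.1 z.2 - fderiv ℝ (heatFlow u₀ (ν * z.1)) z.2) * cutoff R z.2)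
              ≤ ENNReal.ofReal ν * ∫⁻ z in Icc (an m) s ×ˢ (univ : Set (EuclideanSpace ℝ (Fin 3))), ENNReal.ofReal (frobeniusNormSq (G z.1 z.2 - fderiv ℝ (heatFlow u₀ (ν * z.1)) z.2) * cutoff R z.2) :=
                mul_le_mul_right (lintegral_mono_set hsub) _
            _ = ENNReal.ofReal (ν * ∫ r in Icc (an m) s, (∫ x, frobeniusNormSq (G r x - fderiv ℝ (heatFlow u₀ (ν * r)) x) * cutoff R x)) := by
                rw [← hF, ENNReal.ofReal_mul hν.le]
            _ ≤ ENNReal.ofReal (y (an m) + I + Err / R) := ENNReal.ofReal_le_ofReal (by linarith [hy0 s])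
        have hlim : Tendsto (fun m => ENNReal.ofReal (y (an m) + I + Err / R)) atTop
            (𝓝 (ENNReal.ofReal (0 + I + Err / R))) :=
          ENNReal.tendsto_ofReal ((hylim.add tendsto_const_nhds).add tendsto_const_nhds)
        have h := ge_of_tendsto hlim (eventually_atTop.2 ⟨n, hk⟩)
        rw [zero_add, hI] at h
        exact h
    -- #### Step 2: Grönwall
    set φ : ℝ → ℝ≥0∞ := fun s => ENNReal.ofReal (y s) with hφ
    set aK : ℝ → ℝ≥0∞ := fun r => ENNReal.ofReal (α r) with haK
    set B : ℝ≥0∞ := ENNReal.ofReal (β₀ * t + Err / R) with hB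
    have hαae : ∀ s, 0 ≤ᵐ[volume.restrict (Ioo 0 s)] α := fun s =>
      (ae_restrict_iff' measurableSet_Ioo).2 (ae_of_all _ fun r hr => hα0 r hr.1)
    have hφB : ∀ s ∈ Icc 0 t, φ s ≤ B + ∫⁻ r in Ioo 0 s, aK r * φ r := by
      intro s hs
      rcases eq_or_lt_of_le hs.1 with h0 | hs0
      · rw [← h0]
        show ENNReal.ofReal (y 0) ≤ _
        rw [hy00, ENNReal.ofReal_zero]; exact bot_le
      · obtain ⟨h1, -⟩ := step1 s ⟨hs0, hs.2⟩
        have hle : y s ≤ (∫ r in Ioc 0 s, α r * y r) + (β₀ * t + Err / R) := by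
          nlinarith [mul_le_mul_of_nonneg_left hs.2 hβ₀0]
        calc φ s = ENNReal.ofReal (y s) := rfl
          _ ≤ ENNReal.ofReal ((∫ r in Ioc 0 s, α r * y r) + (β₀ * t + Err / R)) := ENNReal.ofReal_le_ofReal hle
          _ ≤ ENNReal.ofReal (∫ r in Ioc 0 s, α r * y r) + B := ENNReal.ofReal_add_le
          _ = (∫⁻ r in Ioo 0 s, aK r * φ r) + B := by
              rw [ofReal_integral_eq_lintegral_ofReal (hαyI s ⟨hs0, hs.2⟩) (hαy0 s ⟨hs0, hs.2⟩),
                setLIntegral_congr (Ioo_ae_eq_Ioc (μ := (volume : Measure ℝ)) (a := 0) (b := s)).symm]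
              congr 1
              refine setLIntegral_congr_fun measurableSet_Ioo fun r hr => ?_
              exact ENNReal.ofReal_mul (hα0 r hr.1)
          _ = B + ∫⁻ r in Ioo 0 s, aK r * φ r := add_comm _ _
    have hφM : ∀ s ∈ Icc 0 t, φ s ≤ ENNReal.ofReal Ymax := fun s hs =>
      ENNReal.ofReal_le_ofReal ((le_abs_self _).trans ((Real.norm_eq_abs _).symm.le.trans (hYmax s hs)))
    have haKt : ∫⁻ r in Ioo 0 t, aK r ≠ ⊤ := by
      obtain ⟨hi, -⟩ := hαI t ht0.le htS.le
      show ∫⁻ r in Ioo 0 t, ENNReal.ofReal (α r) ≠ ⊤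
      rw [← ofReal_integral_eq_lintegral_ofReal hi (hαae t)]
      exact ENNReal.ofReal_ne_top
    have hGW := lintegral_gronwall_le (S := t) ENNReal.ofReal_ne_top ENNReal.ofReal_ne_top hφM haKt hφB
    have hexpA : ∀ s ∈ Icc 0 t, (∫⁻ r in Ioo 0 s, aK r).toReal ≤ A := by
      intro s hs
      obtain ⟨hi, hle⟩ := hαI s hs.1 (hs.2.trans htS.le)
      show (∫⁻ r in Ioo 0 s, ENNReal.ofReal (α r)).toReal ≤ A
      rw [← ofReal_integral_eq_lintegral_ofReal hi (hαae s),
        ENNReal.toReal_ofReal (setIntegral_nonneg measurableSet_Ioo fun r hr => hα0 r hr.1)]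
      exact hle
    have hYtop : ∀ s ∈ Icc 0 t, y s ≤ (β₀ * t + Err / R) * Real.exp A := by
      intro s hs
      have h2 : φ s ≤ ENNReal.ofReal ((β₀ * t + Err / R) * Real.exp A) := by
        refine (hGW s hs).trans ?_
        rw [← ENNReal.ofReal_mul (by positivity)]
        exact ENNReal.ofReal_le_ofReal (mul_le_mul_of_nonneg_left (Real.exp_le_exp.2 (hexpA s hs)) (by positivity))
      exact (ENNReal.ofReal_le_ofReal_iff (by positivity)).1 h2
    -- #### conclusions at radius `R`
    have hβt : β₀ * t ≤ β₀ * S := mul_le_mul_of_nonneg_left htS.le hβ₀0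
    have hErrR : 0 ≤ Err / R := by positivity
    refine ⟨?_, ?_⟩
    · have h := hYtop t ⟨ht0.le, le_rfl⟩
      calc y t ≤ (β₀ * t + Err / R) * Real.exp A := h
        _ ≤ (β₀ * S + Err / R) * Real.exp A := by gcongr
    · obtain ⟨-, h2⟩ := step1 t ⟨ht0, le_rfl⟩
      refine h2.trans (ENNReal.ofReal_le_ofReal ?_)
      have hIle : (∫ r in Ioc 0 t, α r * y r) ≤ ((β₀ * t + Err / R) * Real.exp A) * A := by
        obtain ⟨hi, hle⟩ := hαI t ht0.le htS.le
        have hi' : IntegrableOn α (Ioc 0 t) volume := hi.congr_set_ae (Ioo_ae_eq_Ioc (μ := (volume : Measure ℝ))).symm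
        calc (∫ r in Ioc 0 t, α r * y r) ≤ ∫ r in Ioc 0 t, α r * ((β₀ * t + Err / R) * Real.exp A) := by
              refine setIntegral_mono_on (hαyI t ⟨ht0, le_rfl⟩) (hi'.mul_const _) measurableSet_Ioc fun r hr => ?_
              exact mul_le_mul_of_nonneg_left (hYtop r ⟨hr.1.le, hr.2⟩) (hα0 r hr.1)
          _ = (∫ r in Ioc 0 t, α r) * ((β₀ * t + Err / R) * Real.exp A) := integral_mul_const _ _
          _ ≤ A * ((β₀ * t + Err / R) * Real.exp A) := by
              rw [integral_Ioc_eq_integral_Ioo]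
              exact mul_le_mul_of_nonneg_right hle (by positivity)
          _ = ((β₀ * t + Err / R) * Real.exp A) * A := by ring
      have h3 : (β₀ * t + Err / R) * Real.exp A * A ≤ (β₀ * S + Err / R) * Real.exp A * A := by gcongr
      have h4 : β₀ * t + Err / R ≤ (β₀ * S + Err / R) * Real.exp A := by
        have := mul_le_mul_of_nonneg_left hexp1 (add_nonneg (mul_nonneg hβ₀0 hS.le) hErrR)
        linarith
      have hring : (β₀ * S + Err / R) * (1 + A) * Real.exp A =
          (β₀ * S + Err / R) * Real.exp A * A + (β₀ * S + Err / R) * Real.exp A := by ring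
      linarith
  -- ### Step B: `R → ∞` along `R = n + 1`
  set K : ℝ := (β₀ * S) * (1 + A) * Real.exp A with hK
  have hKeq : M * N3 * S / ν * (1 + A) * Real.exp A = K := by rw [hK, hβ₀]; ring
  rw [hKeq]
  have hErrn : Tendsto (fun n : ℕ => Err / ((n : ℝ) + 1)) atTop (𝓝 0) :=
    tendsto_const_nhds.div_atTop (tendsto_natCast_atTop_atTop.atTop_add tendsto_const_nhds)
  have hKR : Tendsto (fun n : ℕ => (β₀ * S + Err / ((n : ℝ) + 1)) * (1 + A) * Real.exp A) atTop (𝓝 K) := by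
    have h := (((tendsto_const_nhds (x := β₀ * S)).add hErrn).mul_const (1 + A)).mul_const (Real.exp A)
    rw [add_zero] at h
    exact h
  have hKR' : Tendsto (fun n : ℕ => (β₀ * S + Err / ((n : ℝ) + 1)) * Real.exp A) atTop (𝓝 (β₀ * S * Real.exp A)) := by
    have h := ((tendsto_const_nhds (x := β₀ * S)).add hErrn).mul_const (Real.exp A)
    rw [add_zero] at h
    exact h
  have hn1 : ∀ n : ℕ, (0 : ℝ) < (n : ℝ) + 1 := fun n => by positivity
  constructor
  · -- the energy
    have hw3 : MemLp (fun x => u t x - heatFlow u₀ (ν * t) x) 3 volume :=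
      (hcont.1 t ⟨ht0.le, htS⟩).sub (memLp_heatFlow_holds hu₀ (by norm_num) (mul_nonneg hν.le ht0.le))
    set f : ℕ → (EuclideanSpace ℝ (Fin 3)) → ℝ≥0∞ := fun n x => ENNReal.ofReal (‖u t x - heatFlow u₀ (ν * t) x‖ ^ 2 * cutoff ((n : ℝ) + 1) x)
      with hf
    have hfm : ∀ n : ℕ, AEMeasurable (f n) volume := by
      intro n
      have hc : Continuous (cutoff (E := (EuclideanSpace ℝ (Fin 3))) ((n : ℝ) + 1)) :=
        (contDiff_cutoff (E := (EuclideanSpace ℝ (Fin 3))) (n := 0) ((n : ℝ) + 1)).continuous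
      have h1 : AEStronglyMeasurable (fun x => ‖u t x - heatFlow u₀ (ν * t) x‖ ^ 2 * cutoff ((n : ℝ) + 1) x) volume :=
        (hw3.aestronglyMeasurable.norm.pow 2).mul hc.aestronglyMeasurable
      exact h1.aemeasurable.ennreal_ofReal
    have hflim : ∀ x, Tendsto (fun n : ℕ => f n x) atTop (𝓝 (‖u t x - heatFlow u₀ (ν * t) x‖ₑ ^ 2)) := by
      intro x
      obtain ⟨N, hN⟩ := exists_nat_ge ‖x‖
      refine tendsto_atTop_of_eventually_const (i₀ := N) fun n hn => ?_
      show ENNReal.ofReal (‖u t x - heatFlow u₀ (ν * t) x‖ ^ 2 * cutoff ((n : ℝ) + 1) x) = _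
      have hxn : ‖x‖ ≤ (n : ℝ) + 1 := hN.trans (by linarith [(Nat.cast_le.2 hn : (N : ℝ) ≤ n)])
      rw [cutoff_eq_one (hn1 n) hxn, mul_one, ← ofReal_norm, ← ENNReal.ofReal_pow (norm_nonneg _)]
    have hfint : ∀ n : ℕ, ∫⁻ x, f n x = ENNReal.ofReal (∫ x, ‖u t x - heatFlow u₀ (ν * t) x‖ ^ 2 * cutoff ((n : ℝ) + 1) x) := fun n =>
      (ofReal_integral_eq_lintegral_ofReal (integrable_norm_sq_mul_cutoff hw3 (hn1 n))
        (ae_of_all _ fun x => mul_nonneg (sq_nonneg _) (cutoff_nonneg _ x))).symm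
    calc ∫⁻ x, ‖u t x - heatFlow u₀ (ν * t) x‖ₑ ^ 2 = ∫⁻ x, liminf (fun n : ℕ => f n x) atTop :=
          lintegral_congr fun x => ((hflim x).liminf_eq).symm
      _ ≤ liminf (fun n : ℕ => ∫⁻ x, f n x) atTop := lintegral_liminf_le' hfm
      _ = liminf (fun n : ℕ => ENNReal.ofReal (∫ x, ‖u t x - heatFlow u₀ (ν * t) x‖ ^ 2 * cutoff ((n : ℝ) + 1) x)) atTop := by simp_rw [hfint]
      _ ≤ liminf (fun n : ℕ => ENNReal.ofReal ((β₀ * S + Err / ((n : ℝ) + 1)) * Real.exp A)) atTop :=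
          liminf_le_liminf (Eventually.of_forall fun n => ENNReal.ofReal_le_ofReal (stepR ((n : ℝ) + 1) (hn1 n)).1)
      _ = ENNReal.ofReal (β₀ * S * Real.exp A) := (ENNReal.tendsto_ofReal hKR').liminf_eq
      _ ≤ ENNReal.ofReal K := ENNReal.ofReal_le_ofReal (by
          rw [hK]; nlinarith [hexp1, hA0, mul_nonneg hβ₀0 hS.le, Real.exp_pos A, mul_nonneg (mul_nonneg hβ₀0 hS.le) hA0])
  · -- the dissipation
    obtain ⟨-, hFm⟩ := integrableOn_frobeniusNormSq_sub_fderiv_heatFlow_box (ρ := 1) (b' := t) hν hM0 hMb hu₀ hG hG2 ht0 htS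
    have hsub : Ioc 0 t ×ˢ (univ : Set (EuclideanSpace ℝ (Fin 3))) ⊆ Ioo 0 S ×ˢ (univ : Set (EuclideanSpace ℝ (Fin 3))) :=
      prod_mono (fun s hs => ⟨hs.1, hs.2.trans_lt htS⟩) Subset.rfl
    have hFm' : AEStronglyMeasurable (fun z : ℝ × (EuclideanSpace ℝ (Fin 3)) => (frobeniusNormSq (G z.1 z.2 - fderiv ℝ (heatFlow u₀ (ν * z.1)) z.2))) (volume.restrict (Ioc 0 t ×ˢ (univ : Set (EuclideanSpace ℝ (Fin 3))))) :=
      hFm.mono_measure (Measure.restrict_mono hsub le_rfl)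
    set F : ℕ → ℝ × (EuclideanSpace ℝ (Fin 3)) → ℝ≥0∞ := fun n z => ENNReal.ofReal ((frobeniusNormSq (G z.1 z.2 - fderiv ℝ (heatFlow u₀ (ν * z.1)) z.2)) * cutoff ((n : ℝ) + 1) z.2) with hF
    have hFmeas : ∀ n : ℕ, AEMeasurable (F n) (volume.restrict (Ioc 0 t ×ˢ (univ : Set (EuclideanSpace ℝ (Fin 3))))) := fun n =>
      (hFm'.mul (((contDiff_cutoff (E := (EuclideanSpace ℝ (Fin 3))) (n := 0) ((n : ℝ) + 1)).continuous
        : Continuous (cutoff (E := (EuclideanSpace ℝ (Fin 3))) ((n : ℝ) + 1))).comp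
        continuous_snd).aestronglyMeasurable).aemeasurable.ennreal_ofReal
    have hFlim : ∀ z : ℝ × (EuclideanSpace ℝ (Fin 3)), Tendsto (fun n : ℕ => F n z) atTop (𝓝 (ENNReal.ofReal (frobeniusNormSq (G z.1 z.2 - fderiv ℝ (heatFlow u₀ (ν * z.1)) z.2)))) := by
      intro z
      obtain ⟨N, hN⟩ := exists_nat_ge ‖z.2‖
      refine tendsto_atTop_of_eventually_const (i₀ := N) fun n hn => ?_
      show ENNReal.ofReal ((frobeniusNormSq (G z.1 z.2 - fderiv ℝ (heatFlow u₀ (ν * z.1)) z.2)) * cutoff ((n : ℝ) + 1) z.2) = _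
      have hxn : ‖z.2‖ ≤ (n : ℝ) + 1 := hN.trans (by linarith [(Nat.cast_le.2 hn : (N : ℝ) ≤ n)])
      rw [cutoff_eq_one (hn1 n) hxn, mul_one]
    have hFn : ∀ n : ℕ, ∫⁻ z in Ioc 0 t ×ˢ (univ : Set (EuclideanSpace ℝ (Fin 3))), F n z ≤
        ENNReal.ofReal (((β₀ * S + Err / ((n : ℝ) + 1)) * (1 + A) * Real.exp A) / ν) := by
      intro n
      have h := (stepR ((n : ℝ) + 1) (hn1 n)).2
      rw [ENNReal.ofReal_div_of_pos hν]
      refine (ENNReal.le_div_iff_mul_le (Or.inl (ENNReal.ofReal_pos.2 hν).ne') (Or.inl ENNReal.ofReal_ne_top)).2 ?_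
      rw [mul_comm]
      exact h
    have hlimK : Tendsto (fun n : ℕ => ((β₀ * S + Err / ((n : ℝ) + 1)) * (1 + A) * Real.exp A) / ν) atTop
        (𝓝 (K / ν)) := hKR.div_const ν
    calc ENNReal.ofReal ν * ∫⁻ z in Ioc 0 t ×ˢ (univ : Set (EuclideanSpace ℝ (Fin 3))), ENNReal.ofReal (frobeniusNormSq (G z.1 z.2 - fderiv ℝ (heatFlow u₀ (ν * z.1)) z.2))
        = ENNReal.ofReal ν * ∫⁻ z in Ioc 0 t ×ˢ (univ : Set (EuclideanSpace ℝ (Fin 3))), liminf (fun n : ℕ => F n z) atTop := by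
          congr 1
          exact lintegral_congr fun z => ((hFlim z).liminf_eq).symm
      _ ≤ ENNReal.ofReal ν * liminf (fun n : ℕ => ∫⁻ z in Ioc 0 t ×ˢ (univ : Set (EuclideanSpace ℝ (Fin 3))), F n z) atTop :=
          mul_le_mul_right (lintegral_liminf_le' hFmeas) _
      _ ≤ ENNReal.ofReal ν * liminf (fun n : ℕ =>
            ENNReal.ofReal (((β₀ * S + Err / ((n : ℝ) + 1)) * (1 + A) * Real.exp A) / ν)) atTop :=
          mul_le_mul_right (liminf_le_liminf (Eventually.of_forall hFn)) _
      _ = ENNReal.ofReal ν * ENNReal.ofReal (K / ν) := by rw [(ENNReal.tendsto_ofReal hlimK).liminf_eq]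
      _ = ENNReal.ofReal K := by rw [← ENNReal.ofReal_mul hν.le, mul_div_cancel₀ _ hν.ne']

/-- **The caloric remainder lies in the energy class, with an a priori bound** — the case of an
exactly attained datum `u(0) = u₀` (`caloric_remainder_energy_bound_ae`).
[cite: RusinSverak2011, §4 p. 6] -/
theorem caloric_remainder_energy_bound (hν : 0 < ν) (hS : 0 < S) (hM0 : 0 ≤ M)
    (hMb : ∀ x, ‖u₀ x‖ ≤ M) (hu₀ : MemLp u₀ 3 volume) (hdiv₀ : IsWeaklyDivFree u₀)
    (hNS : IsDistributionalNSSolutionOn (slab (EuclideanSpace ℝ (Fin 3)) (Ioo 0 S) isOpen_Ioo) ν 0 u p)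
    (hG : HasWeakSpatialGradientOn (slab (EuclideanSpace ℝ (Fin 3)) (Ioo 0 S) isOpen_Ioo) u G)
    (hG2 : ∀ K ⊆ ((slab (EuclideanSpace ℝ (Fin 3)) (Ioo 0 S) isOpen_Ioo : Opens (ℝ × (EuclideanSpace ℝ (Fin 3)))) : Set (ℝ × (EuclideanSpace ℝ (Fin 3)))), IsCompact K →
      ∫⁻ z in K, ENNReal.ofReal (frobeniusNormSq (G z.1 z.2)) < ∞)
    (hLEI : ∀ φ : ℝ → (EuclideanSpace ℝ (Fin 3)) → ℝ, IsSpaceTimeTestOn (slab (EuclideanSpace ℝ (Fin 3)) (Ioo 0 S) isOpen_Ioo) φ → (∀ t x, 0 ≤ φ t x) →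
      2 * ν * ∫ t, ∫ x, frobeniusNormSq (G t x) * φ t x ≤
        ∫ t, ∫ x, (‖u t x‖ ^ 2 * (timeDeriv φ t x + ν * Δ (φ t) x) +
          (‖u t x‖ ^ 2 + 2 * p t x) * ⟪u t x, gradient (φ t) x⟫ +
          2 * ⟪(0 : ℝ → (EuclideanSpace ℝ (Fin 3)) → (EuclideanSpace ℝ (Fin 3))) t x, u t x⟫ * φ t x))
    (hu3 : MemLp (uncurry u) 3 (volume.restrict (Ioo 0 S ×ˢ univ)))
    (hp32 : MemLp (uncurry p) (3 / 2) (volume.restrict (Ioo 0 S ×ˢ univ)))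
    (hcont : ContinuousInLpOn (Ico 0 S) 3 u) (hinit : u 0 = u₀) {t : ℝ} (ht : t ∈ Ioo 0 S) :
    (∫⁻ x, ‖u t x - heatFlow u₀ (ν * t) x‖ₑ ^ 2 ≤
      ENNReal.ofReal ((M * (∫ x, ‖u₀ x‖ ^ 3) * S / ν) * (1 + (2 * (2 ^ ((3 : ℝ) / 2) * ν ^ (-(1 / 2 : ℝ)) * M) * (2 * S ^ ((1 : ℝ) / 2)))) * Real.exp (2 * (2 ^ ((3 : ℝ) / 2) * ν ^ (-(1 / 2 : ℝ)) * M) * (2 * S ^ ((1 : ℝ) / 2))))) ∧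
    ENNReal.ofReal ν * ∫⁻ z in Ioc 0 t ×ˢ (univ : Set (EuclideanSpace ℝ (Fin 3))),
        ENNReal.ofReal (frobeniusNormSq (G z.1 z.2 - fderiv ℝ (heatFlow u₀ (ν * z.1)) z.2)) ≤
      ENNReal.ofReal ((M * (∫ x, ‖u₀ x‖ ^ 3) * S / ν) * (1 + (2 * (2 ^ ((3 : ℝ) / 2) * ν ^ (-(1 / 2 : ℝ)) * M) * (2 * S ^ ((1 : ℝ) / 2)))) * Real.exp (2 * (2 ^ ((3 : ℝ) / 2) * ν ^ (-(1 / 2 : ℝ)) * M) * (2 * S ^ ((1 : ℝ) / 2)))) :=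
  caloric_remainder_energy_bound_ae hν hS hM0 hMb hu₀ hdiv₀ hNS hG hG2 hLEI hu3 hp32 hcont
    (Eventually.of_forall fun x => by rw [hinit]) ht

end Bound

end Literature.Analysis.FluidPDE

end
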